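import Summits.ABC.IUTFork.Repair.RHQ3LTailBand
import Summits.ABC.IUTFork.Repair.RHHeightClassLadder
import HarnessLib

/-!
# D-0079 RESCUE sub-cell R-H, ROUND 2 Q3 (row 8 «heightclass», Σ₈) — the EXACT l-LAW of the row-8 top cell:
# `r♯(p, e)` in CLOSED FORM on its `t`-piece, and «place in Σ₈ at `l`» ⟺ `a·l² + b·l + c ≥ 0` (abc-iut-rh-num-1's third method, kernel form)

PROOF-ONLY companion (0 definitions) of `RHHeightClass` (abc-iut-rh-typ-8: `StrictMinPow`, `CertVal`, `HBand`, `band_le_of_top`,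
`exists_certVal_cell_iff`, `hBand_iff_cells_of_strictMin`), `RHHeightClassLadder` (`bandCell_int_iff`) and `RHQ3LTailBand` (abc-iut-rh2-q3-typ-1:
`strictMinPow_le_pow_sub`, the two-sided bounds `hexSlice_of_k_le` = k0_ge / `not_hexSlice_of_k_ge` = k0_le). Seat abc-iut-rh-typ-2 gen 3 (Q3-typ lane,
rh-lead R13; rung LADDER-ABC:A2.RESCUE.H), typing VERBATIM the integer shape abc-iut-rh-num-1 g2 posted 2026-08-26T23:20:34Z («the integer shape below is
kernel-sized»; `plan/rescue/R-H/Q3-L0EXACT-rh-num-1.tsv` f61504e3e8b20ab6, engine `q3exact.py` ec17aba641412c8e):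

> «on the t-piece `p^{t−1}(p−1) ≤ e_w = e_v·l ≤ p^t(p−1)` one has `−r♯ = t·e_w − p^t` exactly, so with `j = l⋆` the row-8 top cell is
> `4·[j(e_w−r♯) + (1−r♯) − (j²−1)m_q] = a·l² + b·l + c` with `a = 2(1+t)e_v − m_q`, `b = 2m_q + 2(t−1)e_v − 2p^t`, `c = 3m_q + 4 − 2p^t`;
> Σ₈-membership at `l` ⟺ `a l² + b l + c ≥ 0` on the active piece (top label binds, untied); the NEG set is a finite union of integer intervals,
> `l₀ :=` next admissible prime after the LARGEST ADMISSIBLE NEG PRIME.»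

CONTENTS.
* §1 `r♯` IN CLOSED FORM. `strictMinPow_of_piece`: `p ≥ 2`, `p^{t−1}(p−1) < e < p^t(p−1)` (for `t = 0`: `e < p − 1`) ⟹ `StrictMinPow p e (p^t − t·e)` —
  the untied exponent is `p^t − t·e` with `t` THE PIECE INDEX (replaces the per-type `interval_cases` certificates `strictMinPow_7_<e>` by two
  inequalities); `eq_pow_sub_of_strictMinPow` (uniqueness on the piece); `not_strictMinPow_of_tie`: at a TIE `e = p^s(p−1)` there is NO untied exponent
  for any value (generalises `not_strictMinPow_7_42`); `exists_piece_of_not_tie` / `exists_strictMinPow_of_not_tie`: every `e ≥ 1` that is not a tie lies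
  on exactly such a piece — so the column `r_out_sharp` is TOTAL on untied rows and given by the closed form.
* §2 THE IDENTITY (`ring`) `four_mul_topCell_eq` and `topCell_iff_quad_nonneg`: with `l = 2l⋆+1`, `e = ε·l`, `r = p^t − t·e`:
  `(l⋆²−1)·m ≤ l⋆(e−r) + (1−r) ⟺ 0 ≤ a·l² + b·l + c` with rh-num-1's `(a, b, c)` VERBATIM.
* §3 THE ROW-8 CLAUSE ⟺ THE SIGN. `certVal_cells_iff_topCell`: at an untied place (`StrictMinPow p e r₀`, `e ≥ 1`) the `HBand` clauses at ALL labels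
  `1 ≤ j ≤ l⋆` («∃ r, CertVal p e r ∧ (j²−1)·m ≤ j(e−r) + (1−r)», reals) hold iff the INTEGER top cell holds at `r₀` (CertVal eliminated by
  `exists_certVal_cell_iff`, labels by `band_le_of_top`, ℝ↔ℤ by `bandCell_int_iff`); `certVal_cells_iff_quad_nonneg`: on the `t`-piece this is
  `0 ≤ a·l² + b·l + c` — ONE integer sign per (place, l), no search.
* §4 AT THE GENUINE DATUM `Cor312Prov.pilotDataOfK D K`: `hBandClauses_pilotDataOfK_iff_quad` — at a bad place `w | p` whose fibre index is `e_w = e_v·l`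
  (`e(w|v) = l`, the K-line / table currency `e_w = l·e_v`) with integral pilot degree `m_q(w) = P` (`exists_nat_qPilot_pilotDataOfK`: `2l·P = e(w|v)·ord_v(q_v)`,
  so `P = ord_v(q_v)/2 = n_v/2`), the row-8 clauses at `w` over all labels hold iff `0 ≤ a·l² + b·l + c`; `hBand_pilotDataOfK_iff_quad`: with such data at
  every bad place, `HBand (pilotDataOfK D K)` ⟺ every bad place has `p > 2`, a uniform fibre, and a nonnegative sign — «datum ∈ Σ₈ at l» decided by finitely
  many integer signs.
* Kernel `l₀` CERTIFICATES at pinned HEX data (`λ₆`: `l₀⁸ = 67`, `λ₁₀`: `l₀⁸ = 5591`, NEG at the largest NEG admissible prime, POS at every larger odd `l`)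
  are in the companion `RHQ3L0ExactHex` (same seat).
HONEST SCOPE: `HBand` is row 8's claim-tagged HYPOTHESIS (abc-iut-lens-strengthen-1 / abc-iut-rh-typ-8), never asserted; «in Σ₈ at l» = the hypothesis holds
as typed at that `l`, never «S holds»; the HEX data `λ_k` and their local invariants `(p, e_v, n_v)` are the R-W / rh-num-1 tables' (computed ≠ proved at the
setting); whether a genuine initial Θ-datum has `e(w|v) = l` exactly is an INPUT (`he`), [IUTchI] Def. 3.1 (e) gives
`l ≤ e(w|v)` only (`ThetaData.l_le_ramificationIdx_of_under_mem_VFbad`). TAKES NO SIDE on [IUTchIII] Cor. 3.12 or on any author; nothing here asserts abc.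
[cite: Mochizuki2012, IUTchI Def. 3.1 (b)(c)(e) pp. 61–62, Ex. 3.2 (iv) p. 71; IUTchIV Prop. 1.2 (i)(ii) p. 10, Prop. 1.4 (iii) p. 13] [cite: DupuyHilado2025, §3.3–3.4]
[claim: Mochizuki2012, status: disputed] for every IUT locution.
-/

noncomputable section

open Set Function NumberField IsDedekindDomain

namespace Summit.ABC.IUTFork.Repair.RH.Q3L0Exact

open Summit.ABC.IUTFork.Repair.RHHeightClass Summit.ABC.IUTFork.Repair.RH.Q3LTailBand
open Literature.IUT.LogThetaLattice Literature.IUT.LogVolume Literature.IUT.HodgeTheaters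
open Summit.ABC.IUTFork.Thm311 Summit.ABC.IUTFork.Thm311.Real Summit.ABC.IUTFork.Cor312Prov

/-! ## §1. The untied exponent in closed form: on the `t`-piece, `r♯(p, e) = p^t − t·e` -/

/-- Geometric lower bound (integers, `P ≥ 1`): `P^t·(P−1)·n ≤ P^(t+n) − P^t`. [folklore] -/
theorem pow_mul_sub_one_mul_le_pow_sub (P : ℤ) (hP : 1 ≤ P) (t n : ℕ) :
    P ^ t * (P - 1) * (n : ℤ) ≤ P ^ (t + n) - P ^ t := by
  induction n with
  | zero => simp
  | succ n ih =>
    have hpt : P ^ t ≤ P ^ (t + n) := pow_le_pow_right₀ hP (by omega)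
    have h0 : 0 ≤ P ^ t := pow_nonneg (by linarith) t
    have e1 : P ^ (t + (n + 1)) = P ^ (t + n) * P := by ring
    rw [e1]
    push_cast
    nlinarith [mul_le_mul_of_nonneg_right hpt (sub_nonneg.2 hP)]

/-- Geometric upper bound (integers, `P ≥ 1`): `P^(s+n+1) − P^s ≤ P^(s+n)·(P−1)·(n+1)`. [folklore] -/
theorem pow_sub_pow_le_pow_mul (P : ℤ) (hP : 1 ≤ P) (s n : ℕ) :
    P ^ (s + n + 1) - P ^ s ≤ P ^ (s + n) * (P - 1) * ((n : ℤ) + 1) := by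
  induction n with
  | zero =>
    have h : P ^ (s + 0 + 1) - P ^ s = P ^ (s + 0) * (P - 1) * (((0 : ℕ) : ℤ) + 1) := by push_cast; ring
    exact h.le
  | succ n ih =>
    have hmono : P ^ (s + n) ≤ P ^ (s + n + 1) := pow_le_pow_right₀ hP (by omega)
    have h0 : 0 ≤ P ^ (s + n) := pow_nonneg (by linarith) _
    have e1 : P ^ (s + (n + 1) + 1) = P ^ (s + n + 1) * P := by ring
    have e2 : P ^ (s + (n + 1)) = P ^ (s + n + 1) := by ring
    rw [e1, e2]
    push_cast
    nlinarith [mul_le_mul_of_nonneg_right hmono (mul_nonneg (sub_nonneg.2 hP) (by positivity : (0 : ℤ) ≤ (n : ℤ) + 1))]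

/-- **`r♯` IN CLOSED FORM.** For `p ≥ 2`, on the `t`-piece `p^{t−1}(p−1) < e < p^t(p−1)` (for `t = 0` only the upper inequality `e < p − 1`), the function
`s ↦ p^s − s·e` has its STRICT minimum at `s = t`: `StrictMinPow p e (p^t − t·e)` — increments `p^s(p−1) − e` are negative for `s < t` and positive for `s ≥ t`.
This is the closed form of column `r_out_sharp` behind abc-iut-rh-num-1's `q3exact.py` («on the t-piece one has −r♯ = t·e_w − p^t exactly»). [folklore] -/
theorem strictMinPow_of_piece {p e t : ℕ} (hp : 2 ≤ p)
    (hlo : t = 0 ∨ (p : ℤ) ^ (t - 1) * ((p : ℤ) - 1) < e) (hhi : (e : ℤ) < (p : ℤ) ^ t * ((p : ℤ) - 1)) :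
    StrictMinPow p e ((p : ℤ) ^ t - t * e) := by
  refine ⟨t, rfl, fun t' ht' => ?_⟩
  have hP : (1 : ℤ) ≤ p := by exact_mod_cast (show 1 ≤ p by omega)
  rcases lt_or_gt_of_ne ht' with h | h
  · -- `t' < t`: `t = t' + n + 1`, the lower piece inequality is active
    obtain ⟨n, rfl⟩ : ∃ n, t = t' + n + 1 := ⟨t - t' - 1, by omega⟩
    have hlo' : (p : ℤ) ^ (t' + n) * ((p : ℤ) - 1) < e := by
      rcases hlo with h0 | h0
      · omega
      · simpa using h0
    have hB := pow_sub_pow_le_pow_mul (p : ℤ) hP t' n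
    have hn : (0 : ℤ) < (n : ℤ) + 1 := by positivity
    push_cast
    nlinarith [mul_lt_mul_of_pos_right hlo' hn]
  · -- `t < t'`: `t' = t + n + 1`
    obtain ⟨n, rfl⟩ : ∃ n, t' = t + n + 1 := ⟨t' - t - 1, by omega⟩
    have hA := pow_mul_sub_one_mul_le_pow_sub (p : ℤ) hP t (n + 1)
    have hn : (0 : ℤ) < (n : ℤ) + 1 := by positivity
    rw [show t + n + 1 = t + (n + 1) by ring]
    push_cast at hA ⊢
    nlinarith [mul_lt_mul_of_pos_right hhi hn]

/-- **Uniqueness on the piece**: any untied exponent at `(p, e)` with `e` on the `t`-piece IS `p^t − t·e` (`strictMinPow_unique`). [folklore] -/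
theorem eq_pow_sub_of_strictMinPow {p e t : ℕ} {r : ℤ} (hr : StrictMinPow p e r) (hp : 2 ≤ p)
    (hlo : t = 0 ∨ (p : ℤ) ^ (t - 1) * ((p : ℤ) - 1) < e) (hhi : (e : ℤ) < (p : ℤ) ^ t * ((p : ℤ) - 1)) :
    r = (p : ℤ) ^ t - t * e :=
  strictMinPow_unique hr (strictMinPow_of_piece hp hlo hhi)

/-- **At a TIE there is no untied exponent.** If `e = p^s·(p−1)` (`p ≥ 2`) then `p^s − s·e = p^{s+1} − (s+1)·e` is the (non-strict) minimum of
`u ↦ p^u − u·e`, so `StrictMinPow p e r` fails for EVERY `r` — the recipe's fallback `r := e_w` rows («(tie)»), e.g. `(7, 42)` (`not_strictMinPow_7_42`),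
`(7, 6·7^s)`. [folklore] -/
theorem not_strictMinPow_of_tie {p e s : ℕ} (hp : 2 ≤ p) (he : (e : ℤ) = (p : ℤ) ^ s * ((p : ℤ) - 1)) (r : ℤ) :
    ¬ StrictMinPow p e r := by
  rintro ⟨t₀, ht₀, hmin⟩
  have hP : (1 : ℤ) ≤ p := by exact_mod_cast (show 1 ≤ p by omega)
  -- `f s ≤ f u` for every `u`
  have hmin_s : ∀ u : ℕ, (p : ℤ) ^ s - s * e ≤ (p : ℤ) ^ u - u * e := by
    intro u
    rcases lt_trichotomy u s with h | h | h
    · obtain ⟨n, rfl⟩ : ∃ n, s = u + n + 1 := ⟨s - u - 1, by omega⟩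
      have hB := pow_sub_pow_le_pow_mul (p : ℤ) hP u n
      have hmono : (p : ℤ) ^ (u + n) ≤ (p : ℤ) ^ (u + n + 1) := pow_le_pow_right₀ hP (by omega)
      have hn : (0 : ℤ) ≤ (n : ℤ) + 1 := by positivity
      push_cast
      rw [he]
      nlinarith [mul_le_mul_of_nonneg_right hmono (mul_nonneg (sub_nonneg.2 hP) hn)]
    · rw [h]
    · obtain ⟨n, rfl⟩ : ∃ n, u = s + n + 1 := ⟨u - s - 1, by omega⟩
      have hA := pow_mul_sub_one_mul_le_pow_sub (p : ℤ) hP s (n + 1)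
      have e1 : (p : ℤ) ^ (s + n + 1) = (p : ℤ) ^ (s + (n + 1)) := by ring
      rw [e1]
      push_cast at hA ⊢
      rw [he]
      nlinarith
  -- the tie `f (s+1) = f s`
  have htie : (p : ℤ) ^ (s + 1) - ((s + 1 : ℕ) : ℤ) * e = (p : ℤ) ^ s - s * e := by
    rw [pow_succ]; push_cast; rw [he]; ring
  by_cases h0 : t₀ = s
  · have h1 := hmin (s + 1) (by omega)
    rw [htie] at h1
    rw [h0] at ht₀
    rw [ht₀] at h1
    exact lt_irrefl _ h1
  · have h1 := hmin s (Ne.symm h0)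
    have h2 := hmin_s t₀
    rw [ht₀] at h2
    exact lt_irrefl _ (h1.trans_le h2)

/-- **Every untied `e` lies on a piece**: if `e ≠ p^s(p−1)` for all `s` (`p ≥ 2`), then for `t :=` the least index with `e < p^t(p−1)` the piece
inequalities hold. [folklore] -/
theorem exists_piece_of_not_tie {p e : ℕ} (hp : 2 ≤ p)
    (hnt : ∀ s : ℕ, (e : ℤ) ≠ (p : ℤ) ^ s * ((p : ℤ) - 1)) :
    ∃ t : ℕ, (t = 0 ∨ (p : ℤ) ^ (t - 1) * ((p : ℤ) - 1) < e) ∧ (e : ℤ) < (p : ℤ) ^ t * ((p : ℤ) - 1) := by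
  classical
  have hex : ∃ t : ℕ, (e : ℤ) < (p : ℤ) ^ t * ((p : ℤ) - 1) := by
    refine ⟨e, ?_⟩
    have h1 : (e : ℤ) < (p : ℤ) ^ e := by exact_mod_cast Nat.lt_pow_self (show 1 < p by omega) (n := e)
    have h3 : (1 : ℤ) ≤ (p : ℤ) - 1 := by
      have : (2 : ℤ) ≤ p := by exact_mod_cast hp
      linarith
    nlinarith [mul_le_mul_of_nonneg_left h3 (pow_nonneg (show (0 : ℤ) ≤ p by positivity) e)]
  refine ⟨Nat.find hex, ?_, Nat.find_spec hex⟩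
  rcases Nat.eq_zero_or_pos (Nat.find hex) with h0 | h0
  · exact Or.inl h0
  · right
    have hmin := Nat.find_min hex (m := Nat.find hex - 1) (by omega)
    rw [not_lt] at hmin
    exact lt_of_le_of_ne hmin (fun h => hnt _ h.symm)

/-- **Column `r_out_sharp` is total on untied rows**: `e` not a tie ⟹ an untied exponent exists, namely the closed form on its piece. [folklore] -/
theorem exists_strictMinPow_of_not_tie {p e : ℕ} (hp : 2 ≤ p)
    (hnt : ∀ s : ℕ, (e : ℤ) ≠ (p : ℤ) ^ s * ((p : ℤ) - 1)) :
    ∃ t : ℕ, (t = 0 ∨ (p : ℤ) ^ (t - 1) * ((p : ℤ) - 1) < e) ∧ (e : ℤ) < (p : ℤ) ^ t * ((p : ℤ) - 1) ∧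
      StrictMinPow p e ((p : ℤ) ^ t - t * e) := by
  obtain ⟨t, hlo, hhi⟩ := exists_piece_of_not_tie hp hnt
  exact ⟨t, hlo, hhi, strictMinPow_of_piece hp hlo hhi⟩

/-! ## §2. The identity: the top cell on the piece is the sign of `a·l² + b·l + c` -/

/-- **abc-iut-rh-num-1's IDENTITY, VERBATIM.** With `l = 2l⋆+1`, `e = ε·l`, `r = P − t·e` (`P` standing for `p^t`):
`4·[l⋆(e−r) + (1−r) − (l⋆²−1)·m] = a·l² + b·l + c`, `a = 2(1+t)ε − m`, `b = 2m + 2(t−1)ε − 2P`, `c = 3m + 4 − 2P`. [folklore] -/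
theorem four_mul_topCell_eq (ls ε m P t : ℤ) :
    4 * (ls * ((2 * ls + 1) * ε - (P - t * ((2 * ls + 1) * ε))) + (1 - (P - t * ((2 * ls + 1) * ε))) - (ls ^ 2 - 1) * m) =
      (2 * (1 + t) * ε - m) * (2 * ls + 1) ^ 2 + (2 * m + 2 * (t - 1) * ε - 2 * P) * (2 * ls + 1) + (3 * m + 4 - 2 * P) := by
  ring

/-- **THE EXACT TOP-CELL LAW** (integers): with `e = (2l⋆+1)·ε` and `r = P − t·e`, the row-8 top cell `(l⋆²−1)·m ≤ l⋆(e−r) + (1−r)` holds iff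
`0 ≤ a·l² + b·l + c` (`l = 2l⋆+1`; `a, b, c` as in `four_mul_topCell_eq`). [folklore] -/
theorem topCell_iff_quad_nonneg (ls ε m P t : ℤ) :
    (ls ^ 2 - 1) * m ≤ ls * ((2 * ls + 1) * ε - (P - t * ((2 * ls + 1) * ε))) + (1 - (P - t * ((2 * ls + 1) * ε))) ↔
      0 ≤ (2 * (1 + t) * ε - m) * (2 * ls + 1) ^ 2 + (2 * m + 2 * (t - 1) * ε - 2 * P) * (2 * ls + 1) + (3 * m + 4 - 2 * P) := by
  rw [← four_mul_topCell_eq]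
  constructor <;> intro h <;> linarith

/-! ## §3. The row-8 clause (all labels, `CertVal`) ⟺ the sign -/

/-- **ALL-LABEL CLAUSE ⟺ INTEGER TOP CELL AT `r♯`.** At a place with `e ≥ 1` and an untied exponent `r₀` (`StrictMinPow p e r₀`), the row-8 clauses
«`∃ r, CertVal p e r ∧ (j²−1)·m ≤ j·(e−r) + (1−r)`» (reals, as in `HBand`) at EVERY label `1 ≤ j ≤ l⋆` hold iff the INTEGER top cell holds at `r₀`:
`(l⋆²−1)·m ≤ l⋆·(e − r₀) + (1 − r₀)` — `CertVal` eliminated by `exists_certVal_cell_iff` (the fallback `r = e ≥ 1 ≥ r₀` never helps), the labels by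
`band_le_of_top` (the top label binds, `r₀ ≤ 1 ≤ e`), ℝ ↔ ℤ by `bandCell_int_iff`. [folklore] -/
theorem certVal_cells_iff_topCell {p e : ℕ} {r₀ : ℤ} (he : 1 ≤ e) (h₀ : StrictMinPow p e r₀) (m : ℤ) {ls : ℕ} (hls : 1 ≤ ls) :
    (∀ j : ℕ, 1 ≤ j → j ≤ ls → ∃ r : ℤ, CertVal p e r ∧
        (((j : ℝ)) ^ 2 - 1) * (m : ℝ) ≤ (j : ℝ) * ((e : ℝ) - r) + (1 - r)) ↔
      (((ls : ℤ)) ^ 2 - 1) * m ≤ (ls : ℤ) * ((e : ℤ) - r₀) + (1 - r₀) := by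
  have hcast : ((((ls : ℝ)) ^ 2 - 1) * (m : ℝ) ≤ (ls : ℝ) * ((e : ℝ) - (r₀ : ℝ)) + (1 - (r₀ : ℝ))) ↔
      (((ls : ℤ)) ^ 2 - 1) * m ≤ (ls : ℤ) * ((e : ℤ) - r₀) + (1 - r₀) := by
    have h := bandCell_int_iff ls m (e : ℤ) r₀
    push_cast at h
    exact h
  constructor
  · intro h
    have hc := (exists_certVal_cell_iff he h₀ (by positivity : (0 : ℝ) ≤ (ls : ℝ))).1 (h ls hls le_rfl)
    exact hcast.1 hc
  · intro h j hj hjl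
    refine (exists_certVal_cell_iff he h₀ (by positivity : (0 : ℝ) ≤ (j : ℝ))).2 ?_
    have he' : (1 : ℝ) ≤ (e : ℝ) := by exact_mod_cast he
    have hr' : (r₀ : ℝ) ≤ 1 := by exact_mod_cast strictMinPow_le_one h₀
    exact band_le_of_top hr' he' hj hjl (hcast.2 h)

/-- **THE EXACT l-LAW OF THE ROW-8 PLACE** (abc-iut-rh-num-1's third method, kernel form). At a place of type `(p, e = ε·l)`, `l = 2l⋆+1`, `ε ≥ 1`,
`p ≥ 2`, with `e` on the `t`-piece `p^{t−1}(p−1) < e < p^t(p−1)`: the row-8 clauses at all labels `1 ≤ j ≤ l⋆` hold iff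
`0 ≤ a·l² + b·l + c`, `a = 2(1+t)ε − m`, `b = 2m + 2(t−1)ε − 2p^t`, `c = 3m + 4 − 2p^t` — ONE integer sign per (place, l), no certificate search.
[folklore; the clause is row 8's HYPOTHESIS shape, not asserted] -/
theorem certVal_cells_iff_quad_nonneg {p ε ls t : ℕ} (hp : 2 ≤ p) (hε : 1 ≤ ε) (hls : 1 ≤ ls) (m : ℤ)
    (hlo : t = 0 ∨ (p : ℤ) ^ (t - 1) * ((p : ℤ) - 1) < (((2 * ls + 1) * ε : ℕ) : ℤ))
    (hhi : (((2 * ls + 1) * ε : ℕ) : ℤ) < (p : ℤ) ^ t * ((p : ℤ) - 1)) :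
    (∀ j : ℕ, 1 ≤ j → j ≤ ls → ∃ r : ℤ, CertVal p ((2 * ls + 1) * ε) r ∧
        (((j : ℝ)) ^ 2 - 1) * (m : ℝ) ≤ (j : ℝ) * ((((2 * ls + 1) * ε : ℕ) : ℝ) - r) + (1 - r)) ↔
      0 ≤ (2 * (1 + (t : ℤ)) * ε - m) * (2 * (ls : ℤ) + 1) ^ 2 + (2 * m + 2 * ((t : ℤ) - 1) * ε - 2 * (p : ℤ) ^ t) * (2 * (ls : ℤ) + 1)
        + (3 * m + 4 - 2 * (p : ℤ) ^ t) := by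
  have he : 1 ≤ (2 * ls + 1) * ε := by nlinarith
  have h₀ := strictMinPow_of_piece hp hlo hhi
  rw [certVal_cells_iff_topCell he h₀ m hls]
  have key := topCell_iff_quad_nonneg (ls : ℤ) ε m ((p : ℤ) ^ t) t
  push_cast
  exact key

/-! ## §4. At the genuine `K`-level datum `Cor312Prov.pilotDataOfK D K` -/

section Genuine

variable {F K Fbar : Type} [Field F] [NumberField F] [Field K] [NumberField K] [Algebra F K] [Field Fbar]
  [Algebra F Fbar] [Algebra K Fbar] {E : WeierstrassCurve F} [E.IsElliptic] {l : ℕ} {Pb : BadPlacePredicates K}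
  (D : InitialThetaData F K Fbar E l Pb)

/-- `l = 2·l⋆ + 1` at the genuine datum (`l` an odd prime, [IUTchI] Def. 3.1 (c): `l ≥ 5` prime). -/
theorem two_mul_lstar_add_one_pilotDataOfK : 2 * (pilotDataOfK D K).lstar + 1 = l := by
  have h2 : (pilotDataOfK D K).lstar = (l - 1) / 2 := by unfold PilotData.lstar; rw [pilotDataOfK_l]
  have h5 : 5 ≤ l := D.five_le_l
  have hodd : ¬ 2 ∣ l := by
    intro h
    have := (Nat.Prime.eq_one_or_self_of_dvd D.l_prime 2 h)
    omega
  omega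

/-- **THE EXACT l-LAW AT A GENUINE PLACE.** At a bad place `w | p` of `pilotDataOfK D K` with fibre index `e_w = e_v·l` (INPUT `he`: `e(w|v) = l`
exactly — Def. 3.1 (e) gives only `l ≤ e(w|v)`) on the `t`-piece, and integral pilot degree `m_q(w) = P` (`exists_nat_qPilot_pilotDataOfK`; then
`P = ord_v(q_v)/2`), the row-8 clauses «`∃ r, CertVal p e_w r ∧ (j²−1)·m_q(w) ≤ j(e_w − r) + (1 − r)`» at ALL labels `j = i+1 ≤ l⋆` hold iff
`0 ≤ a·l² + b·l + c` with `a = 2(1+t)e_v − P`, `b = 2P + 2(t−1)e_v − 2p^t`, `c = 3P + 4 − 2p^t`. [cite: Mochizuki2012, IUTchI Def. 3.1 (c)(e) pp. 61–62,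
Ex. 3.2 (iv) p. 71] [claim: Mochizuki2012, status: disputed] — the clause is row 8's hypothesis shape; nothing asserted. -/
theorem hBandClauses_pilotDataOfK_iff_quad (pp : Nat.Primes) (w : (thetaIndex (pilotDataOfK D K)).Fibre (.inr pp))
    (ev t P : ℕ) (hev : 1 ≤ ev)
    (he : haveI : Fact (pp : ℕ).Prime := ⟨pp.2⟩; ramIdx K (placeOf (pilotDataOfK D K) pp.1 w) = ev * l)
    (hP : haveI : Fact (pp : ℕ).Prime := ⟨pp.2⟩; (pilotDataOfK D K).qPilot (placeOf (pilotDataOfK D K) pp.1 w) = P)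
    (hlo : t = 0 ∨ ((pp : ℕ) : ℤ) ^ (t - 1) * (((pp : ℕ) : ℤ) - 1) < ((ev * l : ℕ) : ℤ))
    (hhi : ((ev * l : ℕ) : ℤ) < ((pp : ℕ) : ℤ) ^ t * (((pp : ℕ) : ℤ) - 1)) :
    haveI : Fact (pp : ℕ).Prime := ⟨pp.2⟩
    (∀ i : Fin (pilotDataOfK D K).lstar, ∃ r : ℤ, CertVal pp (ramIdx K (placeOf (pilotDataOfK D K) pp.1 w)) r ∧
        ((((i : ℕ) : ℝ) + 1) ^ 2 - 1) * (pilotDataOfK D K).qPilot (placeOf (pilotDataOfK D K) pp.1 w)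
          ≤ (((i : ℕ) : ℝ) + 1) * ((ramIdx K (placeOf (pilotDataOfK D K) pp.1 w) : ℝ) - r) + (1 - r)) ↔
      0 ≤ (2 * (1 + (t : ℤ)) * ev - P) * (l : ℤ) ^ 2 + (2 * (P : ℤ) + 2 * ((t : ℤ) - 1) * ev - 2 * ((pp : ℕ) : ℤ) ^ t) * (l : ℤ)
        + (3 * (P : ℤ) + 4 - 2 * ((pp : ℕ) : ℤ) ^ t) := by
  haveI : Fact (pp : ℕ).Prime := ⟨pp.2⟩
  have hl : 2 * (pilotDataOfK D K).lstar + 1 = l := two_mul_lstar_add_one_pilotDataOfK D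
  set ls := (pilotDataOfK D K).lstar with hls_def
  have hls : 1 ≤ ls := by have h5 : 5 ≤ l := D.five_le_l; omega
  have hp : 2 ≤ (pp : ℕ) := pp.2.two_le
  have he' : ramIdx K (placeOf (pilotDataOfK D K) pp.1 w) = (2 * ls + 1) * ev := by rw [he, ← hl, Nat.mul_comm]
  rw [he', hP]
  have hlo' : t = 0 ∨ ((pp : ℕ) : ℤ) ^ (t - 1) * (((pp : ℕ) : ℤ) - 1) < (((2 * ls + 1) * ev : ℕ) : ℤ) := by
    rw [show (2 * ls + 1) * ev = ev * l by rw [← hl, Nat.mul_comm]]; exact hlo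
  have hhi' : (((2 * ls + 1) * ev : ℕ) : ℤ) < ((pp : ℕ) : ℤ) ^ t * (((pp : ℕ) : ℤ) - 1) := by
    rw [show (2 * ls + 1) * ev = ev * l by rw [← hl, Nat.mul_comm]]; exact hhi
  have key := certVal_cells_iff_quad_nonneg hp hev hls (P : ℤ) hlo' hhi'
  -- reindex labels `i : Fin l⋆` ↔ `1 ≤ j ≤ l⋆`, `j = i + 1`
  have hre : (∀ i : Fin ls, ∃ r : ℤ, CertVal pp ((2 * ls + 1) * ev) r ∧
        ((((i : ℕ) : ℝ) + 1) ^ 2 - 1) * ((P : ℕ) : ℝ) ≤ (((i : ℕ) : ℝ) + 1) * ((((2 * ls + 1) * ev : ℕ) : ℝ) - r) + (1 - r)) ↔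
      (∀ j : ℕ, 1 ≤ j → j ≤ ls → ∃ r : ℤ, CertVal pp ((2 * ls + 1) * ev) r ∧
        (((j : ℝ)) ^ 2 - 1) * ((P : ℤ) : ℝ) ≤ (j : ℝ) * ((((2 * ls + 1) * ev : ℕ) : ℝ) - r) + (1 - r)) := by
    constructor
    · intro h j hj hjl
      have := h ⟨j - 1, by omega⟩
      have hj' : (((j - 1 : ℕ) : ℝ) + 1) = (j : ℝ) := by
        rw [Nat.cast_sub hj]; push_cast; ring
      simpa [hj'] using this
    · intro h i
      have := h ((i : ℕ) + 1) (by omega) (by omega)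
      push_cast at this ⊢
      simpa using this
  rw [hre, key]
  have hlz : (2 * (ls : ℤ) + 1) = (l : ℤ) := by exact_mod_cast hl
  rw [hlz]

/-- **«DATUM ∈ Σ₈ AT `l`» BY FINITELY MANY INTEGER SIGNS.** If every bad place `w | p` of `pilotDataOfK D K` carries table data `(e_v, t, P)` as in
`hBandClauses_pilotDataOfK_iff_quad` (`e_w = e_v·l` on the `t`-piece, `m_q(w) = P`), then `HBand (pilotDataOfK D K)` holds iff at every bad place `p > 2`,
the fibre over `p` is ramification-uniform, and `0 ≤ a·l² + b·l + c`. [cite: Mochizuki2012, IUTchI Def. 3.1 (b)(c) pp. 61–62; IUTchIV Prop. 1.2 (i)(ii) p. 10]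
[claim: Mochizuki2012, status: disputed] — `HBand` is row 8's HYPOTHESIS; this is its exact evaluation, nothing asserted. -/
theorem hBand_pilotDataOfK_iff_quad
    (ev t P : ∀ pp : Nat.Primes, (thetaIndex (pilotDataOfK D K)).Fibre (.inr pp) → ℕ)
    (hev : ∀ (pp : Nat.Primes) (w : (thetaIndex (pilotDataOfK D K)).Fibre (.inr pp)),
      haveI : Fact (pp : ℕ).Prime := ⟨pp.2⟩
      placeOf (pilotDataOfK D K) pp.1 w ∈ (pilotDataOfK D K).S → 1 ≤ ev pp w)
    (he : ∀ (pp : Nat.Primes) (w : (thetaIndex (pilotDataOfK D K)).Fibre (.inr pp)),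
      haveI : Fact (pp : ℕ).Prime := ⟨pp.2⟩
      placeOf (pilotDataOfK D K) pp.1 w ∈ (pilotDataOfK D K).S → ramIdx K (placeOf (pilotDataOfK D K) pp.1 w) = ev pp w * l)
    (hP : ∀ (pp : Nat.Primes) (w : (thetaIndex (pilotDataOfK D K)).Fibre (.inr pp)),
      haveI : Fact (pp : ℕ).Prime := ⟨pp.2⟩
      placeOf (pilotDataOfK D K) pp.1 w ∈ (pilotDataOfK D K).S → (pilotDataOfK D K).qPilot (placeOf (pilotDataOfK D K) pp.1 w) = P pp w)
    (hlo : ∀ (pp : Nat.Primes) (w : (thetaIndex (pilotDataOfK D K)).Fibre (.inr pp)),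
      haveI : Fact (pp : ℕ).Prime := ⟨pp.2⟩
      placeOf (pilotDataOfK D K) pp.1 w ∈ (pilotDataOfK D K).S →
        t pp w = 0 ∨ ((pp : ℕ) : ℤ) ^ (t pp w - 1) * (((pp : ℕ) : ℤ) - 1) < ((ev pp w * l : ℕ) : ℤ))
    (hhi : ∀ (pp : Nat.Primes) (w : (thetaIndex (pilotDataOfK D K)).Fibre (.inr pp)),
      haveI : Fact (pp : ℕ).Prime := ⟨pp.2⟩
      placeOf (pilotDataOfK D K) pp.1 w ∈ (pilotDataOfK D K).S →
        ((ev pp w * l : ℕ) : ℤ) < ((pp : ℕ) : ℤ) ^ t pp w * (((pp : ℕ) : ℤ) - 1)) :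
    HBand (pilotDataOfK D K) ↔
      ∀ (pp : Nat.Primes) (w : (thetaIndex (pilotDataOfK D K)).Fibre (.inr pp)),
        haveI : Fact (pp : ℕ).Prime := ⟨pp.2⟩
        placeOf (pilotDataOfK D K) pp.1 w ∈ (pilotDataOfK D K).S →
          2 < (pp : ℕ) ∧
          (∀ w' : (thetaIndex (pilotDataOfK D K)).Fibre (.inr pp),
              ramIdx K (placeOf (pilotDataOfK D K) pp.1 w') = ramIdx K (placeOf (pilotDataOfK D K) pp.1 w)) ∧
          0 ≤ (2 * (1 + (t pp w : ℤ)) * ev pp w - P pp w) * (l : ℤ) ^ 2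
              + (2 * (P pp w : ℤ) + 2 * ((t pp w : ℤ) - 1) * ev pp w - 2 * ((pp : ℕ) : ℤ) ^ t pp w) * (l : ℤ)
              + (3 * (P pp w : ℤ) + 4 - 2 * ((pp : ℕ) : ℤ) ^ t pp w) := by
  have hls : 1 ≤ (pilotDataOfK D K).lstar := by
    have hl := two_mul_lstar_add_one_pilotDataOfK D
    have h5 : 5 ≤ l := D.five_le_l
    omega
  unfold HBand
  constructor
  · intro h pp w hw
    haveI : Fact (pp : ℕ).Prime := ⟨pp.2⟩
    obtain ⟨hp2, hunif, -⟩ := h pp ⟨0, by omega⟩ w hw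
    refine ⟨hp2, hunif, ?_⟩
    rw [← hBandClauses_pilotDataOfK_iff_quad D pp w (ev pp w) (t pp w) (P pp w) (hev pp w hw) (he pp w hw) (hP pp w hw)
      (hlo pp w hw) (hhi pp w hw)]
    intro i
    exact (h pp i w hw).2.2
  · intro h pp i w hw
    haveI : Fact (pp : ℕ).Prime := ⟨pp.2⟩
    obtain ⟨hp2, hunif, hq⟩ := h pp w hw
    refine ⟨hp2, hunif, ?_⟩
    exact (hBandClauses_pilotDataOfK_iff_quad D pp w (ev pp w) (t pp w) (P pp w) (hev pp w hw) (he pp w hw) (hP pp w hw)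
      (hlo pp w hw) (hhi pp w hw)).2 hq i

end Genuine

end Summit.ABC.IUTFork.Repair.RH.Q3L0Exact

end
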